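import Summits.QuantumFields.BalabanUV.Beta.EriceRemainderEnclosureHistoryAutonomyComparisonAgeCompositionWindowShares

/-!
# EriceRemainderEnclosureHistoryAutonomyComparisonAgeCompositionChainShares — (E90d) route (N), first order: EVERY PROFILE OF RANGE AT MOST 52 HAS TOTAL WINDOW
# LOAD AT MOST `1` ALONG EVERY FLOW — HENCE THE END FOR EVERY SUCH PROFILE, ANY DAMPING, ANY HORIZON.  The «three loaded ages» of the census disappear:
# the share functional of (E90a)∕(E90b) is bounded for an ARBITRARY load distribution on the ages `1,…,52` by the CHAIN OF SHARES under the integer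
# Markov kernel `M_{kl} = ((k+1)∕(l+1))^{1∕4}` (which lies below the correlations `C_{kl}` of every log-convex trajectory), whose share sum obeys
# `Σ_i α_i∕(Mα)_i ≤ 1 + Σ_t (1−ρ_t)∕(1+ρ_t)` (`ρ_t⁴ = (t+2)∕(t+3)`; proved by induction — merging the oldest age into its neighbour costs at most
# `(1−ρ)∕(1+ρ)`, no matrices) and `1 + Σ_{t<51}(1−ρ_t)∕(1+ρ_t) ≤ 1.4123 ≤ √2`

Cell `pub-balaban`, β-function sub-cell, BINDER row D4 «RemainderConst leaves for Bałaban's split» (`HOME/BINDER-OWNERS.md`; owner lineage `b2b-balaban-beta-an4`;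
this file by co-owner #2 lineage `b2b-balaban-beta-d4-p2`, generation 81), β-FLOW TEAM duty (1), FREEZE (0) honoured (def-free; nothing restated).

HONEST FRAMING (page 1, verbatim and binding).  *"Discharging BetaPertH makes Bałaban's UV stability UNCONDITIONAL — a real constructive-QFT result; it is
NOT the continuum limit and NOT the Clay problem."*  THIS FILE DISCHARGES NOTHING OF THE KIND.  Elementary real algebra ∕ real analysis about ABSTRACT
functionals on a box ]0,γ]^ℕ with displayed floors, profiles and signs, and the FIRST-ORDER renewal objects of route (N) built from them — hypotheses of a
census, not facts; the form, signs, ages and moments of Bałaban's (1.22) limit functional are NOT PRINTED ([I] p. 298; GAPS G-t4-U2-1∕-2) and NOT asserted.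
Row D4 class UNCHANGED (critical-path width 0; instance 0∕1; D4 DISCHARGE NO DATE).  HONEST DEPENDENCY: continuum YM on T⁴ ⇐ BetaPertH ∧ nine spine
estimates (0/9 proved); BetaPertH ⇐ (D1) ∧ (D4) ∧ CAP+tail; G-an2-4 gates asym, D1 and NE2/3/4.

THE POINT (README `HOME/b2b-balaban-beta-d4-p2/g81/e90/README.md` §2(d)).  (E90c) proved the total-window-load bound for the census profiles.  For a
profile carried by ALL the ages `1,…,K−1` the share functional still gives `T ≤ (√2∕2)Σ_k s_k` ((E90b) `load_le_share`); the shares `s_k = α_k∕(Cα)_k`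
(`α_k = L_k√(h(m+2k))`, `C_{kl} = h(m+k+l)∕√(h(m+2k)h(m+2l))`) are dominated termwise by those of any smaller kernel, and the integer chain
`M_{kl} = Π_{t∈[k−1,l−1)} ρ_t`, `ρ_t⁴ = (t+2)∕(t+3)`, is admissible: `M_{kl}⁴ = (k+1)∕(l+1) ≤ 2k∕(k+l) ≤ a_{m+2k}∕a_{m+k+l} ≤ C_{kl}⁴` (concavity from the
pin; `(k−1)(l−k) ≥ 0`).  The chain of shares is bounded by INDUCTION ON THE OLDEST AGE: merging the two oldest loads `(α_n, α_{n+1})` into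
`α_n + ρ_nα_{n+1}` at position `n` leaves every older window read unchanged and moves the share sum by `x∕(ρB + (1−ρ²)x) − ρx∕B ≤ (1−ρ)∕(1+ρ)`
(`peel_le`; defect `ρ(1−ρ)((1+ρ)x − B)²`).  The numerics `Σ_{t<51} (1−ρ_t)∕(1+ρ_t) ≤ 0.4123` (seven blocks via `(1−ρ)∕(1+ρ) = (1−ρ⁴)∕((1+ρ)²(1+ρ²))`)
close the range `K − 1 ≤ 52`; the exact chain sum passes `√2 − 1` between 53 and 54 ages, so `52` is where THIS proof stops (README §4: the truth for
the total load is k ≈ 5·10³, gen 80).  NOT CLAIMED: range `> 52`; k-uniformity; anything printed — NOT B12 Thm 2, NOT BetaPertH, NOT continuum, NOT Clay.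

WHAT IS PROVED ([folklore]; 0 `def`, 0 sorry).  §1 `peel_le`, **`chain_shares_le`**; §2 `f_le_of_pow_four`, `rho_facts`, `f_rho_le`, `block_le`,
**`chain_numerics`**; §3 `prod_telescope`, **`chain_kernel_le`**, `load_le_chain_share`, **`total_load_le_one_of_range`**, **`flow_nonneg_of_range`**.
-/
noncomputable section
open Finset

namespace Summit.QuantumFields.BalabanUV.Beta.EriceRemainderEnclosureHistoryAutonomyComparisonAgeCompositionChainShares

open Literature.MathematicalPhysics.QuantumFieldTheory.Balaban1983to89
open Literature.MathematicalPhysics.QuantumFieldTheory.Balaban1983to89.T4BetaStationary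
open Literature.MathematicalPhysics.QuantumFieldTheory.Balaban1983to89.T4BetaFlowWellPosed
open Summit.QuantumFields.BalabanUV.Beta.EriceRemainderEnclosureHistoryAutonomyOrder (strictAnti_of_memFlow)
open Summit.QuantumFields.BalabanUV.Beta.EriceRemainderEnclosureHistoryAutonomyComparisonAgeCompositionThreeAgesMassCap (flow_nonneg_of_window_loads_le_one)
open Summit.QuantumFields.BalabanUV.Beta.EriceRemainderEnclosureHistoryAutonomyComparisonAgeCompositionWindowShares (mul_sq_le_from_pin load_le_share)

variable {B : (ℕ → ℝ) → ℝ} {γ b gIR : ℝ} {L : ℕ → ℝ} {K : ℕ} {h g : ℕ → ℝ}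

/-! ## §1 The chain of shares under a Markov kernel: peeling the oldest age -/

/-- **PEELING ONE AGE COSTS AT MOST `(1−ρ)∕(1+ρ)`**: for `B > 0`, `x ≥ 0`, `0 < ρ < 1`,
`x∕(ρB + (1−ρ²)x) − ρx∕B ≤ (1−ρ)∕(1+ρ)` (cleared of denominators the difference is `ρ(1−ρ)·((1+ρ)x − B)²`). [folklore] -/
theorem peel_le {B x ρ : ℝ} (hB : 0 < B) (hx : 0 ≤ x) (hρ0 : 0 < ρ) (hρ1 : ρ < 1) :
    x / (ρ * B + (1 - ρ ^ 2) * x) - ρ * x / B ≤ (1 - ρ) / (1 + ρ) := by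
  have hρ2 : 0 < 1 - ρ ^ 2 := by nlinarith
  have hD : 0 < ρ * B + (1 - ρ ^ 2) * x := by positivity
  rw [div_sub_div _ _ hD.ne' hB.ne', div_le_div_iff₀ (mul_pos hD hB) (by linarith)]
  nlinarith [mul_nonneg (mul_nonneg hρ0.le (sub_nonneg.2 hρ1.le)) (sq_nonneg ((1 + ρ) * x - B)), mul_pos hB hD, mul_pos hρ0 hB,
    mul_nonneg hρ0.le hx]

/-- **THE CHAIN OF SHARES.**  For a Markov (AR(1)) kernel `M_{ij} = Π_{t∈[i,j)} ρ_t · Π_{t∈[j,i)} ρ_t` (`0 < ρ_t < 1`) on the positions `0,…,n` and loads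
`α ≥ 0` not all zero: `Σ_{i≤n} α_i∕(Σ_{j≤n} M_{ij}α_j) ≤ 1 + Σ_{t<n} (1−ρ_t)∕(1+ρ_t)` — by induction on `n`, merging the oldest position into its neighbour
(`α''_{n} = α_n + ρ_nα_{n+1}` leaves every older window read unchanged) and `peel_le`. [folklore] -/
theorem chain_shares_le {ρ : ℕ → ℝ} (hρ0 : ∀ t, 0 < ρ t) (hρ1 : ∀ t, ρ t < 1) :
    ∀ (n : ℕ) (α : ℕ → ℝ), (∀ i, 0 ≤ α i) → (0 < ∑ i ∈ range (n + 1), α i) →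
      ∑ i ∈ range (n + 1), α i / (∑ j ∈ range (n + 1), ((∏ t ∈ Ico i j, ρ t) * (∏ t ∈ Ico j i, ρ t)) * α j)
        ≤ 1 + ∑ t ∈ range n, (1 - ρ t) / (1 + ρ t) := by
  intro n
  induction n with
  | zero =>
    intro α hα hpos
    simp only [zero_add, sum_range_one, Ico_self, prod_empty, one_mul, range_zero, sum_empty, add_zero] at hpos ⊢
    rw [div_self hpos.ne']
  | succ n ih =>
    intro α hα hpos
    have hM : ∀ i j : ℕ, 0 < (∏ t ∈ Ico i j, ρ t) * (∏ t ∈ Ico j i, ρ t) := fun i j =>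
      mul_pos (prod_pos fun t _ => hρ0 t) (prod_pos fun t _ => hρ0 t)
    have htop : ∀ i, i ≤ n → (∏ t ∈ Ico i (n + 1), ρ t) * (∏ t ∈ Ico (n + 1) i, ρ t) = ((∏ t ∈ Ico i n, ρ t) * (∏ t ∈ Ico n i, ρ t)) * ρ n := by
      intro i hi
      rw [prod_Ico_succ_top hi, Ico_eq_empty_of_le (by omega : i ≤ n + 1), Ico_eq_empty_of_le hi, prod_empty]; ring
    have hbot : ∀ j, j ≤ n → (∏ t ∈ Ico (n + 1) j, ρ t) * (∏ t ∈ Ico j (n + 1), ρ t) = ((∏ t ∈ Ico n j, ρ t) * (∏ t ∈ Ico j n, ρ t)) * ρ n := by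
      intro j hj
      rw [prod_Ico_succ_top hj, Ico_eq_empty_of_le (by omega : j ≤ n + 1), Ico_eq_empty_of_le hj, prod_empty]; ring
    obtain ⟨α'', hα''⟩ : ∃ f : ℕ → ℝ, f = fun i => if i = n then α n + ρ n * α (n + 1) else α i := ⟨_, rfl⟩
    have hα''0 : ∀ i, 0 ≤ α'' i := by
      intro i; rw [hα'']; dsimp only; split_ifs
      · exact add_nonneg (hα n) (mul_nonneg (hρ0 n).le (hα (n + 1)))
      · exact hα i
    have hα''lt : ∀ i, i < n → α'' i = α i := fun i hi => by rw [hα'']; dsimp only; rw [if_neg (by omega)]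
    have hα''n : α'' n = α n + ρ n * α (n + 1) := by rw [hα'']; dsimp only; rw [if_pos rfl]
    obtain ⟨β'', hβ''⟩ : ∃ g : ℕ → ℝ, g = fun i => ∑ j ∈ range (n + 1), ((∏ t ∈ Ico i j, ρ t) * (∏ t ∈ Ico j i, ρ t)) * α'' j := ⟨_, rfl⟩
    have hβ : ∀ i, β'' i = ∑ j ∈ range (n + 1), ((∏ t ∈ Ico i j, ρ t) * (∏ t ∈ Ico j i, ρ t)) * α'' j := fun i => by rw [hβ'']
    have hread : ∀ i, i ≤ n → ∑ j ∈ range (n + 2), ((∏ t ∈ Ico i j, ρ t) * (∏ t ∈ Ico j i, ρ t)) * α j = β'' i := by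
      intro i hi
      rw [hβ i, sum_range_succ, sum_range_succ, sum_range_succ, htop i hi, hα''n]
      have e : ∑ j ∈ range n, (∏ t ∈ Ico i j, ρ t) * (∏ t ∈ Ico j i, ρ t) * α'' j = ∑ j ∈ range n, (∏ t ∈ Ico i j, ρ t) * (∏ t ∈ Ico j i, ρ t) * α j :=
        sum_congr rfl fun j hj => by rw [hα''lt j (mem_range.mp hj)]
      rw [e]
      ring
    have hlast : ∑ j ∈ range (n + 2), ((∏ t ∈ Ico (n + 1) j, ρ t) * (∏ t ∈ Ico j (n + 1), ρ t)) * α j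
        = ρ n * β'' n + (1 - ρ n ^ 2) * α (n + 1) := by
      rw [hβ n, sum_range_succ, sum_range_succ, sum_range_succ, Ico_self, prod_empty, one_mul, hα''n, Ico_self, prod_empty,
        hbot n (le_refl n), Ico_self, prod_empty]
      have e : ∀ j ∈ range n, (∏ t ∈ Ico (n + 1) j, ρ t) * (∏ t ∈ Ico j (n + 1), ρ t) * α j
          = ρ n * ((∏ t ∈ Ico n j, ρ t) * (∏ t ∈ Ico j n, ρ t) * α'' j) := by
        intro j hj
        have hjn := mem_range.mp hj
        rw [hbot j hjn.le, hα''lt j hjn]; ring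
      rw [sum_congr rfl e, ← mul_sum]
      ring
    have hsum'' : 0 < ∑ i ∈ range (n + 1), α'' i := by
      rw [sum_range_succ, sum_congr rfl fun j hj => hα''lt j (mem_range.mp hj), hα''n]
      rw [sum_range_succ, sum_range_succ] at hpos
      nlinarith [hα (n + 1), hρ0 n, hρ1 n, sum_nonneg fun i (_ : i ∈ range n) => hα i, hα n,
        mul_nonneg (hρ0 n).le (hα (n + 1))]
    have hβpos : 0 < β'' n := by
      rw [hβ n]
      obtain ⟨j, hj, hjpos⟩ : ∃ j ∈ range (n + 1), 0 < α'' j := by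
        by_contra hno
        have hno' : ∀ j ∈ range (n + 1), α'' j ≤ 0 := fun j hj => not_lt.mp fun hlt => hno ⟨j, hj, hlt⟩
        have : ∑ i ∈ range (n + 1), α'' i ≤ 0 := sum_nonpos hno'
        linarith
      exact lt_of_lt_of_le (mul_pos (hM n j) hjpos)
        (single_le_sum (f := fun j => (∏ t ∈ Ico n j, ρ t) * (∏ t ∈ Ico j n, ρ t) * α'' j) (fun j _ => mul_nonneg (hM n j).le (hα''0 j)) hj)
    have hIH := ih α'' hα''0 hsum''
    rw [sum_range_succ, sum_range_succ _ n, hlast]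
    rw [sum_congr rfl fun i hi => by rw [hread i (by have := mem_range.mp hi; omega)]]
    rw [hread n (le_refl n)]
    rw [sum_range_succ] at hIH
    rw [sum_congr rfl fun i hi => show α'' i / _ = α i / _ by rw [hα''lt i (mem_range.mp hi)]] at hIH
    have hIH' : ∑ i ∈ range n, α i / β'' i + (α n + ρ n * α (n + 1)) / β'' n ≤ 1 + ∑ t ∈ range n, (1 - ρ t) / (1 + ρ t) := by
      have e : ∀ i, ∑ j ∈ range (n + 1), (∏ t ∈ Ico i j, ρ t) * (∏ t ∈ Ico j i, ρ t) * α'' j = β'' i := fun i => (hβ i).symm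
      simp only [e, hα''n] at hIH
      exact hIH
    have hpeel := peel_le hβpos (hα (n + 1)) (hρ0 n) (hρ1 n)
    rw [add_div, mul_div_assoc] at hIH'
    rw [mul_div_assoc] at hpeel
    have ef : ∑ t ∈ range (n + 1), (1 - ρ t) / (1 + ρ t) = ∑ t ∈ range n, (1 - ρ t) / (1 + ρ t) + (1 - ρ n) / (1 + ρ n) :=
      sum_range_succ _ _
    linarith

/-! ## §2 Numerics of the integer chain: `1 + Σ_{t<51} f(ρ_t) ≤ √2` for `ρ_t⁴ = (t+2)∕(t+3)` -/

/-- `f(ρ) = (1−ρ)∕(1+ρ)` through the fourth power: `0 ≤ ρ < 1`, `0 < r`, `r⁴ ≤ ρ⁴`, `0 < c ≤ (1+r)²(1+r²)` ⟹ `(1−ρ)∕(1+ρ) ≤ (1−ρ⁴)∕c`. [folklore] -/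
theorem f_le_of_pow_four {ρ r c : ℝ} (hρ0 : 0 ≤ ρ) (hρ1 : ρ < 1) (hr : 0 < r) (hr4 : r ^ 4 ≤ ρ ^ 4) (hc0 : 0 < c)
    (hc : c ≤ (1 + r) ^ 2 * (1 + r ^ 2)) : (1 - ρ) / (1 + ρ) ≤ (1 - ρ ^ 4) / c := by
  have hrρ : r ≤ ρ := (pow_le_pow_iff_left₀ hr.le hρ0 (by norm_num : (4 : ℕ) ≠ 0)).mp hr4
  have hden : c ≤ (1 + ρ) ^ 2 * (1 + ρ ^ 2) := hc.trans (by nlinarith [mul_le_mul hrρ hrρ hr.le hρ0, sq_nonneg r, sq_nonneg ρ])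
  have e : (1 - ρ) / (1 + ρ) = (1 - ρ ^ 4) / ((1 + ρ) ^ 2 * (1 + ρ ^ 2)) := by
    rw [div_eq_div_iff (by positivity) (by positivity)]; ring
  rw [e]
  exact div_le_div_of_nonneg_left (by nlinarith [pow_lt_one₀ hρ0 hρ1 (by norm_num : (4:ℕ) ≠ 0)]) hc0 hden

/-- The chain parameter `ρ_t = ((t+2)∕(t+3))^{1∕4}` as an iterated square root: positivity, `< 1`, fourth power. [folklore] -/
theorem rho_facts (t : ℕ) : 0 < Real.sqrt (Real.sqrt (((t : ℝ) + 2) / ((t : ℝ) + 3))) ∧ Real.sqrt (Real.sqrt (((t : ℝ) + 2) / ((t : ℝ) + 3))) < 1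
    ∧ Real.sqrt (Real.sqrt (((t : ℝ) + 2) / ((t : ℝ) + 3))) ^ 4 = ((t : ℝ) + 2) / ((t : ℝ) + 3) := by
  have hq0 : 0 < ((t : ℝ) + 2) / ((t : ℝ) + 3) := by positivity
  have hq1 : ((t : ℝ) + 2) / ((t : ℝ) + 3) < 1 := by rw [div_lt_one (by positivity)]; linarith
  refine ⟨Real.sqrt_pos.2 (Real.sqrt_pos.2 hq0), ?_, ?_⟩
  · rw [Real.sqrt_lt' one_pos, one_pow, Real.sqrt_lt' one_pos, one_pow]; exact hq1
  · rw [show (4 : ℕ) = 2 * 2 by norm_num, pow_mul, Real.sq_sqrt (Real.sqrt_nonneg _), Real.sq_sqrt hq0.le]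

/-- One block of the chain sum: for `b ≤ t` (so `ρ_t ≥ ρ_b ≥ r`), `f(ρ_t) ≤ (1∕(t+3))∕c`. [folklore] -/
theorem f_rho_le {b t : ℕ} {r c : ℝ} (hbt : b ≤ t) (hr : 0 < r) (hr4 : r ^ 4 ≤ ((b : ℝ) + 2) / ((b : ℝ) + 3)) (hc0 : 0 < c)
    (hc : c ≤ (1 + r) ^ 2 * (1 + r ^ 2)) :
    (1 - Real.sqrt (Real.sqrt (((t : ℝ) + 2) / ((t : ℝ) + 3)))) / (1 + Real.sqrt (Real.sqrt (((t : ℝ) + 2) / ((t : ℝ) + 3))))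
      ≤ 1 / (((t : ℝ) + 3) * c) := by
  obtain ⟨h0, h1, h4⟩ := rho_facts t
  have hbt' : (b : ℝ) ≤ t := by exact_mod_cast hbt
  have hmono : ((b : ℝ) + 2) / ((b : ℝ) + 3) ≤ ((t : ℝ) + 2) / ((t : ℝ) + 3) := by
    rw [div_le_div_iff₀ (by positivity) (by positivity)]; nlinarith
  have := f_le_of_pow_four h0.le h1 hr (by rw [h4]; exact hr4.trans hmono) hc0 hc
  rw [h4] at this
  have e : (1 - ((t : ℝ) + 2) / ((t : ℝ) + 3)) / c = 1 / (((t : ℝ) + 3) * c) := by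
    field_simp; ring
  rwa [e] at this

/-- A block of the chain sum is at most the block's harmonic sum over `c`. [folklore] -/
theorem block_le {b b' : ℕ} {r c : ℝ} (hr : 0 < r) (hr4 : r ^ 4 ≤ ((b : ℝ) + 2) / ((b : ℝ) + 3)) (hc0 : 0 < c)
    (hc : c ≤ (1 + r) ^ 2 * (1 + r ^ 2)) :
    ∑ t ∈ Ico b b', (1 - Real.sqrt (Real.sqrt (((t : ℝ) + 2) / ((t : ℝ) + 3)))) / (1 + Real.sqrt (Real.sqrt (((t : ℝ) + 2) / ((t : ℝ) + 3))))
      ≤ (∑ t ∈ Ico b b', 1 / ((t : ℝ) + 3)) / c := by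
  rw [sum_div]
  exact sum_le_sum fun t ht => by
    have := f_rho_le (mem_Ico.mp ht).1 hr hr4 hc0 hc
    rwa [div_div]

/-- **THE NUMERICS OF THE INTEGER CHAIN**: `1 + Σ_{t<n} (1−ρ_t)∕(1+ρ_t) ≤ √2` for every `n ≤ 51`, `ρ_t = ((t+2)∕(t+3))^{1∕4}` (seven blocks
`[0,1),[1,2),[2,4),[4,8),[8,16),[16,32),[32,51)` with `ρ ≥ 0.9036, 0.9306, 0.9457, 0.9621, 0.9764, 0.9865, 0.9927`; total `≤ 0.4123 ≤ √2 − 1`). [folklore] -/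
theorem chain_numerics {n : ℕ} (hn : n ≤ 51) :
    1 + ∑ t ∈ range n, (1 - Real.sqrt (Real.sqrt (((t : ℝ) + 2) / ((t : ℝ) + 3)))) / (1 + Real.sqrt (Real.sqrt (((t : ℝ) + 2) / ((t : ℝ) + 3))))
      ≤ Real.sqrt 2 := by
  have hs : (1.41421 : ℝ) ≤ Real.sqrt 2 := by
    rw [Real.le_sqrt (by norm_num) (by norm_num)]; norm_num
  have hf0 : ∀ t ∈ range 51, 0 ≤ (1 - Real.sqrt (Real.sqrt (((t : ℝ) + 2) / ((t : ℝ) + 3)))) / (1 + Real.sqrt (Real.sqrt (((t : ℝ) + 2) / ((t : ℝ) + 3)))) :=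
    fun t _ => by obtain ⟨h0, h1, _⟩ := rho_facts t; exact div_nonneg (by linarith) (by linarith)
  have hmono := sum_le_sum_of_subset_of_nonneg (Finset.range_mono hn) fun t ht _ => hf0 t ht
  refine le_trans (by linarith [hmono]) (?_ : 1 + ∑ t ∈ range 51, _ ≤ Real.sqrt 2)
  have h0 := block_le (b := 0) (b' := 1) (r := 0.9036) (c := 6.582) (by norm_num) (by norm_num) (by norm_num) (by norm_num)
  have h1 := block_le (b := 1) (b' := 2) (r := 0.9306) (c := 6.955) (by norm_num) (by norm_num) (by norm_num) (by norm_num)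
  have h2 := block_le (b := 2) (b' := 4) (r := 0.9457) (c := 7.171) (by norm_num) (by norm_num) (by norm_num) (by norm_num)
  have h3 := block_le (b := 4) (b' := 8) (r := 0.9621) (c := 7.413) (by norm_num) (by norm_num) (by norm_num) (by norm_num)
  have h4 := block_le (b := 8) (b' := 16) (r := 0.9764) (c := 7.630) (by norm_num) (by norm_num) (by norm_num) (by norm_num)
  have h5 := block_le (b := 16) (b' := 32) (r := 0.9865) (c := 7.786) (by norm_num) (by norm_num) (by norm_num) (by norm_num)
  have h6 := block_le (b := 32) (b' := 51) (r := 0.9927) (c := 7.883) (by norm_num) (by norm_num) (by norm_num) (by norm_num)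
  have e0 : ∑ t ∈ Ico (0:ℕ) 1, 1 / ((t : ℝ) + 3) = 1 / 3 := by norm_num [sum_Ico_eq_sum_range, sum_range_succ]
  have e1 : ∑ t ∈ Ico (1:ℕ) 2, 1 / ((t : ℝ) + 3) = 1 / 4 := by norm_num [sum_Ico_eq_sum_range, sum_range_succ]
  have e2 : ∑ t ∈ Ico (2:ℕ) 4, 1 / ((t : ℝ) + 3) ≤ 0.36667 := by norm_num [sum_Ico_eq_sum_range, sum_range_succ]
  have e3 : ∑ t ∈ Ico (4:ℕ) 8, 1 / ((t : ℝ) + 3) ≤ 0.47897 := by norm_num [sum_Ico_eq_sum_range, sum_range_succ]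
  have e4 : ∑ t ∈ Ico (8:ℕ) 16, 1 / ((t : ℝ) + 3) ≤ 0.56614 := by norm_num [sum_Ico_eq_sum_range, sum_range_succ]
  have e5 : ∑ t ∈ Ico (16:ℕ) 32, 1 / ((t : ℝ) + 3) ≤ 0.62311 := by norm_num [sum_Ico_eq_sum_range, sum_range_succ]
  have e6 : ∑ t ∈ Ico (32:ℕ) 51, 1 / ((t : ℝ) + 3) ≤ 0.43871 := by norm_num [sum_Ico_eq_sum_range, sum_range_succ]
  rw [range_eq_Ico]
  rw [← sum_Ico_consecutive _ (by norm_num : 0 ≤ 32) (by norm_num : 32 ≤ 51), ← sum_Ico_consecutive _ (by norm_num : 0 ≤ 16) (by norm_num : 16 ≤ 32),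
    ← sum_Ico_consecutive _ (by norm_num : 0 ≤ 8) (by norm_num : 8 ≤ 16), ← sum_Ico_consecutive _ (by norm_num : 0 ≤ 4) (by norm_num : 4 ≤ 8),
    ← sum_Ico_consecutive _ (by norm_num : 0 ≤ 2) (by norm_num : 2 ≤ 4), ← sum_Ico_consecutive _ (by norm_num : 0 ≤ 1) (by norm_num : 1 ≤ 2)]
  rw [e0] at h0; rw [e1] at h1
  have h2' := h2.trans (div_le_div_of_nonneg_right e2 (by norm_num))
  have h3' := h3.trans (div_le_div_of_nonneg_right e3 (by norm_num))
  have h4' := h4.trans (div_le_div_of_nonneg_right e4 (by norm_num))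
  have h5' := h5.trans (div_le_div_of_nonneg_right e5 (by norm_num))
  have h6' := h6.trans (div_le_div_of_nonneg_right e6 (by norm_num))
  norm_num at h0 h1 h2' h3' h4' h5' h6' ⊢
  linarith

/-! ## §3 Along flows: the integer chain lies below the correlations; every profile of range ≤ 52 -/

/-- The telescoping product `Π_{t∈[i,j)} (t+2)∕(t+3) = (i+2)∕(j+2)`. [folklore] -/
theorem prod_telescope {i j : ℕ} (hij : i ≤ j) : ∏ t ∈ Ico i j, (((t : ℝ) + 2) / ((t : ℝ) + 3)) = ((i : ℝ) + 2) / ((j : ℝ) + 2) := by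
  induction j, hij using Nat.le_induction with
  | base => rw [Ico_self, prod_empty, div_self (by positivity)]
  | succ j hij ih =>
    rw [prod_Ico_succ_top hij, ih, div_mul_div_comm, div_eq_div_iff (by positivity) (by positivity)]
    push_cast; ring

/-- **THE INTEGER CHAIN LIES BELOW THE CORRELATIONS**: for positions `i ≤ j` (ages `i+1 ≤ j+1`) along every flow,
`(Π_{t∈[i,j)} ρ_t)·√(h(m+2i+2))·√(h(m+2j+2)) ≤ h(m+i+j+2)`, `ρ_t⁴ = (t+2)∕(t+3)` — fourth powers: `((i+2)∕(j+2))·h(m+2i+2)²h(m+2j+2)² ≤ h(m+i+j+2)⁴`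
by concavity from the pin (`(2i+2)h(m+2i+2)² ≤ (i+j+2)h(m+i+j+2)²`), antitonicity, and `(i+2)(i+j+2) ≤ (j+2)(2i+2)`. [folklore] -/
theorem chain_kernel_le (hmono : ∀ u v : ℕ → ℝ, SeqBox γ u → SeqBox γ v → (∀ j, u j ≤ v j) → B u ≤ B v) (hb : 0 < b)
    (hlo : ∀ u, SeqBox γ u → b ≤ B u) (hh : SeqBox γ h) (hf : MemFlow B gIR h) (m : ℕ) {i j : ℕ} (hij : i ≤ j) :
    (∏ t ∈ Ico i j, Real.sqrt (Real.sqrt (((t : ℝ) + 2) / ((t : ℝ) + 3)))) * (Real.sqrt (h (m + 2 * (i + 1))) * Real.sqrt (h (m + 2 * (j + 1))))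
      ≤ h (m + (i + 1) + (j + 1)) := by
  have hpos : ∀ n, 0 < h n := fun n => (hh n).1
  have hanti := (strictAnti_of_memFlow hb hlo hh hf).antitone
  have hP0 : 0 ≤ ∏ t ∈ Ico i j, Real.sqrt (Real.sqrt (((t : ℝ) + 2) / ((t : ℝ) + 3))) := prod_nonneg fun t _ => Real.sqrt_nonneg _
  have hP4 : (∏ t ∈ Ico i j, Real.sqrt (Real.sqrt (((t : ℝ) + 2) / ((t : ℝ) + 3)))) ^ 4 = ((i : ℝ) + 2) / ((j : ℝ) + 2) := by
    rw [← prod_pow, prod_congr rfl fun t _ => (rho_facts t).2.2, prod_telescope hij]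
  have hi2 := hpos (m + 2 * (i + 1)); have hj2 := hpos (m + 2 * (j + 1)); have hij2 := hpos (m + (i + 1) + (j + 1))
  have hs4 : (Real.sqrt (h (m + 2 * (i + 1))) * Real.sqrt (h (m + 2 * (j + 1)))) ^ 4 = h (m + 2 * (i + 1)) ^ 2 * h (m + 2 * (j + 1)) ^ 2 := by
    rw [mul_pow, show (4 : ℕ) = 2 * 2 by norm_num, pow_mul, pow_mul, Real.sq_sqrt hi2.le, Real.sq_sqrt hj2.le]
  have hc := mul_sq_le_from_pin hmono hb hlo hh hf m (2 * (i + 1)) (j - i)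
  rw [show m + 2 * (i + 1) + (j - i) = m + (i + 1) + (j + 1) by omega, Nat.cast_sub hij] at hc
  push_cast at hc
  have ha : h (m + 2 * (j + 1)) ^ 2 ≤ h (m + (i + 1) + (j + 1)) ^ 2 := pow_le_pow_left₀ (hpos _).le (hanti (by omega)) 2
  have hijR : (i : ℝ) ≤ j := by exact_mod_cast hij
  have h4 : ((∏ t ∈ Ico i j, Real.sqrt (Real.sqrt (((t : ℝ) + 2) / ((t : ℝ) + 3)))) * (Real.sqrt (h (m + 2 * (i + 1))) * Real.sqrt (h (m + 2 * (j + 1))))) ^ 4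
      ≤ h (m + (i + 1) + (j + 1)) ^ 4 := by
    rw [mul_pow, hP4, hs4]
    rw [div_mul_eq_mul_div, div_le_iff₀ (by positivity)]
    have h1 : ((i : ℝ) + 2) * h (m + 2 * (i + 1)) ^ 2 ≤ ((j : ℝ) + 2) * h (m + (i + 1) + (j + 1)) ^ 2 := by
      have hkey : ((i : ℝ) + 2) * ((2 * ((i : ℝ) + 1)) * h (m + 2 * (i + 1)) ^ 2) ≤ ((j : ℝ) + 2) * ((2 * ((i : ℝ) + 1)) * h (m + (i + 1) + (j + 1)) ^ 2) := by
        have := mul_le_mul_of_nonneg_left hc (show (0 : ℝ) ≤ (i : ℝ) + 2 by positivity)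
        nlinarith [sq_nonneg (h (m + (i + 1) + (j + 1))), mul_nonneg (mul_nonneg (Nat.cast_nonneg i) (sub_nonneg.2 hijR)) (sq_nonneg (h (m + (i + 1) + (j + 1))))]
      have h2i : (0 : ℝ) < 2 * ((i : ℝ) + 1) := by positivity
      nlinarith [hkey]
    calc ((i : ℝ) + 2) * (h (m + 2 * (i + 1)) ^ 2 * h (m + 2 * (j + 1)) ^ 2)
        = (((i : ℝ) + 2) * h (m + 2 * (i + 1)) ^ 2) * h (m + 2 * (j + 1)) ^ 2 := by ring
      _ ≤ (((j : ℝ) + 2) * h (m + (i + 1) + (j + 1)) ^ 2) * h (m + (i + 1) + (j + 1)) ^ 2 := mul_le_mul h1 ha (sq_nonneg _) (by positivity)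
      _ = h (m + (i + 1) + (j + 1)) ^ 4 * ((j : ℝ) + 2) := by ring
  exact (pow_le_pow_iff_left₀ (by positivity) (hpos _).le (by norm_num : (4 : ℕ) ≠ 0)).mp h4

/-- **LOAD ≤ CHAIN SHARE**: along every flow, for the position `i < n` (age `i+1 < K = n+1`), with `α_j = L_{j+1}√(h(m+2j+2))` and the integer-chain
kernel `M`, `(i+1)·L_{i+1}h(m+i+1)³∕2 ≤ (√2∕2)·α_i∕(Σ_{j<n} M_{ij}α_j)` ((E90b) `load_le_share`, then the window reads dominate `√(h(m+2i+2))·(Mα)_i` by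
`chain_kernel_le`). [folklore] -/
theorem load_le_chain_share (hmono : ∀ u v : ℕ → ℝ, SeqBox γ u → SeqBox γ v → (∀ j, u j ≤ v j) → B u ≤ B v)
    (hL : ∀ k, 0 ≤ L k) (hb : 0 < b) (hlo : ∀ u, SeqBox γ u → b ≤ B u) {n : ℕ} (hdom : ∀ u, SeqBox γ u → ∑ k ∈ range (n + 1), L k * u k ≤ B u)
    (hh : SeqBox γ h) (hf : MemFlow B gIR h) (m : ℕ) {i : ℕ} (hi : i < n) :
    (((i + 1 : ℕ) : ℝ)) * (L (i + 1) * h (m + (i + 1)) ^ 3 / 2)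
      ≤ Real.sqrt 2 / 2 * ((L (i + 1) * Real.sqrt (h (m + 2 * (i + 1))))
          / ∑ j ∈ range n, ((∏ t ∈ Ico i j, Real.sqrt (Real.sqrt (((t : ℝ) + 2) / ((t : ℝ) + 3)))) *
              (∏ t ∈ Ico j i, Real.sqrt (Real.sqrt (((t : ℝ) + 2) / ((t : ℝ) + 3))))) * (L (j + 1) * Real.sqrt (h (m + 2 * (j + 1))))) := by
  have hpos : ∀ n, 0 < h n := fun n => (hh n).1
  have hρ0 : ∀ t : ℕ, 0 < Real.sqrt (Real.sqrt (((t : ℝ) + 2) / ((t : ℝ) + 3))) := fun t => (rho_facts t).1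
  have hM : ∀ i j : ℕ, 0 < (∏ t ∈ Ico i j, Real.sqrt (Real.sqrt (((t : ℝ) + 2) / ((t : ℝ) + 3)))) *
      (∏ t ∈ Ico j i, Real.sqrt (Real.sqrt (((t : ℝ) + 2) / ((t : ℝ) + 3)))) := fun i j =>
    mul_pos (prod_pos fun t _ => hρ0 t) (prod_pos fun t _ => hρ0 t)
  have hx := load_le_share hmono hL hb hlo hdom hh hf (show i + 1 < n + 1 by omega) m
  refine hx.trans (mul_le_mul_of_nonneg_left ?_ (by positivity))
  rcases (hL (i + 1)).eq_or_lt with hLi | hLi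
  · rw [← hLi]; simp
  have hsq := Real.sqrt_pos.2 (hpos (m + 2 * (i + 1)))
  have hsq2 : Real.sqrt (h (m + 2 * (i + 1))) ^ 2 = h (m + 2 * (i + 1)) := Real.sq_sqrt (hpos _).le
  have hden : 0 < ∑ j ∈ range n, ((∏ t ∈ Ico i j, Real.sqrt (Real.sqrt (((t : ℝ) + 2) / ((t : ℝ) + 3)))) *
      (∏ t ∈ Ico j i, Real.sqrt (Real.sqrt (((t : ℝ) + 2) / ((t : ℝ) + 3))))) * (L (j + 1) * Real.sqrt (h (m + 2 * (j + 1)))) := by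
    refine lt_of_lt_of_le ?_ (single_le_sum (f := fun j => ((∏ t ∈ Ico i j, Real.sqrt (Real.sqrt (((t : ℝ) + 2) / ((t : ℝ) + 3)))) *
      (∏ t ∈ Ico j i, Real.sqrt (Real.sqrt (((t : ℝ) + 2) / ((t : ℝ) + 3))))) * (L (j + 1) * Real.sqrt (h (m + 2 * (j + 1)))))
      (fun j _ => mul_nonneg (hM i j).le (mul_nonneg (hL _) (Real.sqrt_nonneg _))) (mem_range.mpr hi))
    exact mul_pos (hM i i) (mul_pos hLi (Real.sqrt_pos.2 (hpos _)))
  have hcmp : Real.sqrt (h (m + 2 * (i + 1))) * ∑ j ∈ range n, ((∏ t ∈ Ico i j, Real.sqrt (Real.sqrt (((t : ℝ) + 2) / ((t : ℝ) + 3)))) *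
      (∏ t ∈ Ico j i, Real.sqrt (Real.sqrt (((t : ℝ) + 2) / ((t : ℝ) + 3))))) * (L (j + 1) * Real.sqrt (h (m + 2 * (j + 1))))
      ≤ ∑ l ∈ range (n + 1), L l * h (m + (i + 1) + l) := by
    rw [sum_range_succ' (fun l => L l * h (m + (i + 1) + l)), mul_sum]
    have htail : 0 ≤ L 0 * h (m + (i + 1) + 0) := mul_nonneg (hL 0) (hpos _).le
    refine le_trans (sum_le_sum fun j hj => ?_) (le_add_of_nonneg_right htail)
    have hjn := mem_range.mp hj
    rcases le_total i j with hij | hji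
    · rw [Ico_eq_empty_of_le hij, prod_empty, mul_one]
      have hk := chain_kernel_le hmono hb hlo hh hf m hij
      have := mul_le_mul_of_nonneg_left hk (hL (j + 1))
      nlinarith [this]
    · rw [Ico_eq_empty_of_le hji, prod_empty, one_mul]
      have hk := chain_kernel_le hmono hb hlo hh hf m hji
      rw [show m + (j + 1) + (i + 1) = m + (i + 1) + (j + 1) by ring] at hk
      have := mul_le_mul_of_nonneg_left hk (hL (j + 1))
      nlinarith [this]
  calc L (i + 1) * h (m + 2 * (i + 1)) / ∑ l ∈ range (n + 1), L l * h (m + (i + 1) + l)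
      ≤ L (i + 1) * h (m + 2 * (i + 1)) / (Real.sqrt (h (m + 2 * (i + 1))) * ∑ j ∈ range n,
          ((∏ t ∈ Ico i j, Real.sqrt (Real.sqrt (((t : ℝ) + 2) / ((t : ℝ) + 3)))) *
            (∏ t ∈ Ico j i, Real.sqrt (Real.sqrt (((t : ℝ) + 2) / ((t : ℝ) + 3))))) * (L (j + 1) * Real.sqrt (h (m + 2 * (j + 1))))) :=
        div_le_div_of_nonneg_left (mul_nonneg (hL _) (hpos _).le) (mul_pos hsq hden) hcmp
    _ = L (i + 1) * Real.sqrt (h (m + 2 * (i + 1))) / ∑ j ∈ range n,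
          ((∏ t ∈ Ico i j, Real.sqrt (Real.sqrt (((t : ℝ) + 2) / ((t : ℝ) + 3)))) *
            (∏ t ∈ Ico j i, Real.sqrt (Real.sqrt (((t : ℝ) + 2) / ((t : ℝ) + 3))))) * (L (j + 1) * Real.sqrt (h (m + 2 * (j + 1)))) := by
        rw [div_eq_div_iff (mul_pos hsq hden).ne' hden.ne']
        have e : Real.sqrt (h (m + 2 * (i + 1))) * Real.sqrt (h (m + 2 * (i + 1))) = h (m + 2 * (i + 1)) := Real.mul_self_sqrt (hpos _).le
        calc L (i + 1) * h (m + 2 * (i + 1)) * ∑ j ∈ range n,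
              ((∏ t ∈ Ico i j, Real.sqrt (Real.sqrt (((t : ℝ) + 2) / ((t : ℝ) + 3)))) *
                (∏ t ∈ Ico j i, Real.sqrt (Real.sqrt (((t : ℝ) + 2) / ((t : ℝ) + 3))))) * (L (j + 1) * Real.sqrt (h (m + 2 * (j + 1))))
            = L (i + 1) * (Real.sqrt (h (m + 2 * (i + 1))) * Real.sqrt (h (m + 2 * (i + 1)))) * ∑ j ∈ range n,
              ((∏ t ∈ Ico i j, Real.sqrt (Real.sqrt (((t : ℝ) + 2) / ((t : ℝ) + 3)))) *
                (∏ t ∈ Ico j i, Real.sqrt (Real.sqrt (((t : ℝ) + 2) / ((t : ℝ) + 3))))) * (L (j + 1) * Real.sqrt (h (m + 2 * (j + 1)))) := by rw [e]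
          _ = _ := by ring

/-- **ROUTE (N), FIRST ORDER — EVERY PROFILE OF RANGE AT MOST 52: THE TOTAL WINDOW LOAD IS AT MOST `1` ALONG EVERY FLOW.**  `B` an isotone memory on
the box with floor `b > 0` dominating the profile `L ≥ 0` on the ages `< K` with `K ≤ 53` — NO restriction on how the load is distributed among the ages
`1, …, K−1`; `h` a box solution from any pin.  Then `Σ_{k<K} k·L_kh(m+k)³∕2 ≤ 1` at every pin: each load is at most `√2∕2` times its share, the shares are
dominated by the integer Markov chain `ρ_t⁴ = (t+2)∕(t+3)` (`chain_kernel_le`), the chain of shares sums to at most `1 + Σ_t(1−ρ_t)∕(1+ρ_t)`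
(`chain_shares_le`), and that is `≤ √2` up to 51 links (`chain_numerics`). [folklore] -/
theorem total_load_le_one_of_range (hmono : ∀ u v : ℕ → ℝ, SeqBox γ u → SeqBox γ v → (∀ j, u j ≤ v j) → B u ≤ B v)
    (hL : ∀ k, 0 ≤ L k) (hb : 0 < b) (hlo : ∀ u, SeqBox γ u → b ≤ B u) (hdom : ∀ u, SeqBox γ u → ∑ k ∈ range K, L k * u k ≤ B u)
    (hh : SeqBox γ h) (hf : MemFlow B gIR h) (hK : K ≤ 53) (m : ℕ) :
    ∑ k ∈ range K, (k : ℝ) * (L k * h (m + k) ^ 3 / 2) ≤ 1 := by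
  have hpos : ∀ n, 0 < h n := fun n => (hh n).1
  rcases Nat.eq_zero_or_pos K with hK0 | hK0
  · subst hK0; simp
  obtain ⟨n, rfl⟩ : ∃ n, K = n + 1 := ⟨K - 1, by omega⟩
  rw [sum_range_succ']
  simp only [Nat.cast_zero, zero_mul, add_zero]
  rcases Nat.eq_zero_or_pos n with hn0 | hn0
  · subst hn0; simp
  obtain ⟨p, rfl⟩ : ∃ p, n = p + 1 := ⟨n - 1, by omega⟩
  have hρ0 : ∀ t : ℕ, 0 < Real.sqrt (Real.sqrt (((t : ℝ) + 2) / ((t : ℝ) + 3))) := fun t => (rho_facts t).1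
  have hρ1 : ∀ t : ℕ, Real.sqrt (Real.sqrt (((t : ℝ) + 2) / ((t : ℝ) + 3))) < 1 := fun t => (rho_facts t).2.1
  have hα0 : ∀ j, 0 ≤ L (j + 1) * Real.sqrt (h (m + 2 * (j + 1))) := fun j => mul_nonneg (hL _) (Real.sqrt_nonneg _)
  by_cases hz : ∑ j ∈ range (p + 1), L (j + 1) * Real.sqrt (h (m + 2 * (j + 1))) = 0
  · have hall : ∀ j ∈ range (p + 1), L (j + 1) * Real.sqrt (h (m + 2 * (j + 1))) = 0 := (sum_eq_zero_iff_of_nonneg fun j _ => hα0 j).mp hz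
    have hL0 : ∀ j ∈ range (p + 1), L (j + 1) = 0 := fun j hj => by
      rcases mul_eq_zero.mp (hall j hj) with h0 | h0
      · exact h0
      · exact absurd h0 (Real.sqrt_pos.2 (hpos _)).ne'
    rw [sum_eq_zero fun j hj => by rw [hL0 j hj]; simp]
    norm_num
  have hαpos : 0 < ∑ j ∈ range (p + 1), L (j + 1) * Real.sqrt (h (m + 2 * (j + 1))) :=
    lt_of_le_of_ne (sum_nonneg fun j _ => hα0 j) (Ne.symm hz)
  have hchain := chain_shares_le hρ0 hρ1 p (fun j => L (j + 1) * Real.sqrt (h (m + 2 * (j + 1)))) hα0 hαpos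
  have hnum := chain_numerics (show p ≤ 51 by omega)
  have hterms := sum_le_sum fun i hi => load_le_chain_share hmono hL hb hlo hdom hh hf m (mem_range.mp hi : i < p + 1)
  rw [← mul_sum] at hterms
  have hs2 : Real.sqrt 2 / 2 * Real.sqrt 2 = 1 := by
    rw [div_mul_eq_mul_div, Real.mul_self_sqrt (by norm_num)]; norm_num
  calc ∑ i ∈ range (p + 1), (((i + 1 : ℕ) : ℝ)) * (L (i + 1) * h (m + (i + 1)) ^ 3 / 2)
      ≤ Real.sqrt 2 / 2 * ∑ i ∈ range (p + 1), (L (i + 1) * Real.sqrt (h (m + 2 * (i + 1))))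
          / ∑ j ∈ range (p + 1), ((∏ t ∈ Ico i j, Real.sqrt (Real.sqrt (((t : ℝ) + 2) / ((t : ℝ) + 3)))) *
              (∏ t ∈ Ico j i, Real.sqrt (Real.sqrt (((t : ℝ) + 2) / ((t : ℝ) + 3))))) * (L (j + 1) * Real.sqrt (h (m + 2 * (j + 1)))) := hterms
    _ ≤ Real.sqrt 2 / 2 * Real.sqrt 2 := mul_le_mul_of_nonneg_left (hchain.trans hnum) (by positivity)
    _ = 1 := hs2

/-- **THE END FOR EVERY PROFILE OF RANGE AT MOST 52, ALONG EVERY FLOW, ANY DAMPING, ANY HORIZON** ((E89b) `flow_nonneg_of_window_loads_le_one` with its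
hypothesis on the total window load DISCHARGED by `total_load_le_one_of_range`): `1 ≤ K ≤ 53`, the memory isotone with floor `b > 0` dominating `L ≥ 0`,
`h` a box solution, `0 < g ≤ 1`; then `0 ≤ ε m ≤ e m` at every pin for every admissible excess. [folklore] -/
theorem flow_nonneg_of_range (hmono : ∀ u v : ℕ → ℝ, SeqBox γ u → SeqBox γ v → (∀ j, u j ≤ v j) → B u ≤ B v)
    (hL : ∀ k, 0 ≤ L k) (hb : 0 < b) (hlo : ∀ u, SeqBox γ u → b ≤ B u) (hdom : ∀ u, SeqBox γ u → ∑ k ∈ range K, L k * u k ≤ B u)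
    (hh : SeqBox γ h) (hf : MemFlow B gIR h) (hg : ∀ t, 0 < g t ∧ g t ≤ 1) (hK1 : 1 ≤ K) (hK : K ≤ 53) {N : ℕ} (hKN : K ≤ N)
    {KL : ℕ → ℕ → ℕ → ℝ}
    (hKL : ∀ k n l, KL k n l = if 0 < k ∧ k < K ∧ l < k then L k * h (n + k) ^ 3 / 2 * ∏ t ∈ Ico (n + 1 + l) (n + k + 1), g t else 0)
    {KA : ℕ → ℕ → ℕ → ℝ} {RA : ℕ → (ℕ → ℝ) → ℕ → ℝ}
    (hRA : ∀ i v m, RA i v m = ∑ l ∈ range K, KA i m l * v (m + 1 + l))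
    (hKA : ∀ i m l, KA i m l = KL i m l + KA (i + 1) m l) (hKAtop : ∀ m l, KA K m l = 0)
    {e ε : ℕ → ℝ} (he0 : ∀ m, 0 ≤ e m) (hea : ∀ m, e (m + 1) ≤ e m)
    (hεt : ∀ m, N < m → ε m = 0) (hεrec : ∀ m, ε m = e m - RA 1 ε m) : ∀ m, 0 ≤ ε m ∧ ε m ≤ e m :=
  flow_nonneg_of_window_loads_le_one hL hh hg hK1 hKN hKL hRA hKA hKAtop
    (fun m => total_load_le_one_of_range hmono hL hb hlo hdom hh hf hK m) he0 hea hεt hεrec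

end Summit.QuantumFields.BalabanUV.Beta.EriceRemainderEnclosureHistoryAutonomyComparisonAgeCompositionChainShares

end
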